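import Literature.Probability.RandomPlanarGeometry.HexSAWPolygonCellsBaseDataRUPolygon
import Literature.Probability.RandomPlanarGeometry.HexSAWPolygonCellsBaseDataC2
import Literature.Probability.RandomPlanarGeometry.HexSAWPolygonCellsE
import HarnessLib

/-!
# Cell calculus for honeycomb polygon surgery, XXX: the BASE DATA of «OMEGA» assembled (classification of bases; `baseImage`, `basePort`, `baseExc`) and
# THEOREM V for `ι = (omegaRec baseImage basePort ·).1`

Topic `Literature/Probability/RandomPlanarGeometry` (lane «pcv-sawmu», a-p4 g22; sequel of XXII (`omegaRec`, `PortInv`), XXIII (EX/ER), XXV (C₂, LEMMA X),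
XXVIII/XXIX (RU-family), XXIV (`isPolygon_bdry_peel`, LEMMA ISO), XV (`topCell`, `top_trichotomy`)).

* `baseImage B`, `basePort B`, `baseExc B` — by cases on the top hexagon `t = topCell B`: class X (`L t ∈ B`) ↦ flip; class R (`L t ∉ B`, `LR t ∈ B`) ↦ roof
  (exceptional host = the last run hexagon); the 3-chain ↦ `F₂`; the roof-end situation below the spike top ↦ the RU flip / leaf at the chain hexagon
  (witnesses by choice); anything else ↦ `B` itself (never a base).
* ★ `base_data` — for a brick set `B` with `bdry B` a polygon, `#B ≥ 2` and no peelable top (`peel B = B`): `PortInv (baseExc B) B (baseImage B) (basePort B)`,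
  `perim (baseImage B) = perim B + 2`, and `IsPolygon brickWallGraph (bdry (baseImage B))`.
* ★ `omega_hX` — `∀ c ∈ S ∖ peel S, LL c ∉ baseExc (peel S)` (LEMMA X).
* ★★ **THEOREM V** `theoremV` — for a brick set `S` with `bdry S` a honeycomb polygon and `#(peel S) ≥ 2`, the image `omegaImage S := (omegaRec baseImage basePort S).1`
  is a brick set with `perim (omegaImage S) = perim S + 2` and `bdry (omegaImage S)` a honeycomb polygon.

Sources: N. Madras, G. Slade, *The Self-Avoiding Walk* (1993), §3.2, Theorem 3.2.3 (3.2.3) and its proof pp. 64–65 [MadrasSlade1993]; I. Jensen, J. Phys.: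
Conf. Ser. 42 (2006) 163 [Jensen2006HoneycombPolygons].  Label (lane): LANE THEOREM for an open combinatorial item (`q_N(ℍ) ≤ q_{N+2}(ℍ)`, even `N ≥ 12`:
THEOREM V = validity of the injection, lane result a-p4 g21/g22); not a literature claim.
-/

open Finset

namespace Literature.Probability.RandomPlanarGeometry.SAW

namespace HexCell

/-! ### The base data by cases -/

/-- The RU case of a set `B` with top `t`: the roof-end situation below the spike top. [cite: MadrasSlade1993, §3.2 (proof of Theorem 3.2.3)] -/
def IsRUCase (B : Finset Cell) : Prop :=
  L (topCell B) ∉ B ∧ LR (topCell B) ∉ B ∧ ¬ IsChain3 B ∧ RoofEndSituation (B.erase (topCell B)) (LL (topCell B))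

/-- Witness `t₀` of the RU case (choice). [cite: MadrasSlade1993, §3.2 (proof of Theorem 3.2.3)] -/
noncomputable def ruTop {B : Finset Cell} (h : IsRUCase B) : Cell := Classical.choose h.2.2.2

/-- Witness `k` of the RU case (choice). [cite: MadrasSlade1993, §3.2 (proof of Theorem 3.2.3)] -/
noncomputable def ruLen {B : Finset Cell} (h : IsRUCase B) : ℕ := Classical.choose (Classical.choose_spec h.2.2.2)

/-- The defining properties of the RU witnesses. [cite: MadrasSlade1993, §3.2 (proof of Theorem 3.2.3)] -/
theorem ruSpec {B : Finset Cell} (h : IsRUCase B) :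
    IsLexmax (B.erase (topCell B)) (ruTop h) ∧ L (ruTop h) ∉ B.erase (topCell B) ∧ 2 ≤ ruLen h ∧
      (∀ i < ruLen h, runCell (ruTop h) i ∈ B.erase (topCell B)) ∧ runCell (ruTop h) (ruLen h) ∉ B.erase (topCell B) ∧
      LL (topCell B) = runCell (ruTop h) (ruLen h - 1) :=
  Classical.choose_spec (Classical.choose_spec h.2.2.2)

/-- Witness `p` of the 3-chain case (choice). [cite: MadrasSlade1993, §3.2 (proof of Theorem 3.2.3)] -/
noncomputable def chain3Base {B : Finset Cell} (h : IsChain3 B) : Cell := Classical.choose h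

/-- [cite: MadrasSlade1993, §3.2 (proof of Theorem 3.2.3)] -/
theorem chain3Base_spec {B : Finset Cell} (h : IsChain3 B) : B = {chain3Base h, UR (chain3Base h), UR (UR (chain3Base h))} := Classical.choose_spec h

open Classical in
/-- **The base image `C(B)`** by cases. [cite: MadrasSlade1993, §3.2, Theorem 3.2.3 (3.2.3) (the surgery at the largest point, with the lane's RU / C₂ variants)] -/
noncomputable def baseImage (B : Finset Cell) : Finset Cell :=
  if L (topCell B) ∈ B then flipImage B (topCell B)
  else if LR (topCell B) ∈ B then roofImage B (topCell B)
  else if h3 : IsChain3 B then {UL (UR (chain3Base h3)), UR (chain3Base h3), R (chain3Base h3), chain3Base h3}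
  else if hru : IsRUCase B then
    (if L (chainCell (ruTop hru) (chainIdx (B.erase (topCell B)) (ruTop hru))) ∈ B.erase (topCell B)
      then ruFlipImage (B.erase (topCell B)) (ruTop hru) (ruLen hru) else ruLeafImage (B.erase (topCell B)) (ruTop hru) (ruLen hru))
  else B

open Classical in
/-- **The base port table** by cases. [cite: MadrasSlade1993, §3.2 (proof of Theorem 3.2.3)] -/
noncomputable def basePort (B : Finset Cell) : Cell → Cell :=
  if L (topCell B) ∈ B then portX (topCell B)
  else if LR (topCell B) ∈ B then portR (topCell B) (runLen B (topCell B))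
  else if h3 : IsChain3 B then fun _ => UR (UL (UR (chain3Base h3)))
  else if hru : IsRUCase B then
    (if L (chainCell (ruTop hru) (chainIdx (B.erase (topCell B)) (ruTop hru))) ∈ B.erase (topCell B)
      then ruFlipPort (B.erase (topCell B)) (ruTop hru) else ruLeafPort (B.erase (topCell B)) (ruTop hru))
  else fun d => d

open Classical in
/-- **The exceptional hosts** by cases: only class R has one. [cite: MadrasSlade1993, §3.2 (proof of Theorem 3.2.3)] -/
noncomputable def baseExc (B : Finset Cell) : Finset Cell :=
  if L (topCell B) ∈ B then ∅ else if LR (topCell B) ∈ B then roofExc B (topCell B) else ∅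

/-! ### Classification of bases -/

/-- A fixed point of the peeling with at least two hexagons and polygonal boundary is of class X, class R, the 3-chain or in the RU case.
[cite: MadrasSlade1993, §3.2 (proof of Theorem 3.2.3: the cases at the lexicographically largest point)] -/
theorem base_cases {B : Finset Cell} (hB : IsBrickSet B) (hP : IsPolygon brickWallGraph (bdry B)) (h2 : 2 ≤ #B) (hfix : peel B = B) :
    L (topCell B) ∈ B ∨ (L (topCell B) ∉ B ∧ LR (topCell B) ∈ B) ∨ (L (topCell B) ∉ B ∧ LR (topCell B) ∉ B ∧ IsChain3 B) ∨ IsRUCase B := by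
  classical
  have hne : B.Nonempty := card_pos.1 (by omega)
  have ht := isLexmax_topCell hne
  rcases top_trichotomy ht with hL | ⟨hL, hLR⟩ | ⟨hL, hLR, hsub⟩
  · exact Or.inl hL
  · exact Or.inr (Or.inl ⟨hL, hLR⟩)
  · -- the top is a spike (not isolated: LEMMA ISO); since `B` has no peelable top, it is the 3-chain or the roof-end situation
    obtain ⟨c', hc', hc'ne⟩ : ∃ c' ∈ B, c' ≠ topCell B := by
      by_contra h; push Not at h
      have : B ⊆ {topCell B} := fun x hx => mem_singleton.2 (h x hx)
      have := card_le_card this; rw [card_singleton] at this; omega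
    have hiso := nbrs_inter_nonempty_of_isPolygon hB hP ht.1 ⟨c', hc', hc'ne⟩
    have hspike : IsSpikeTop B (topCell B) := by
      refine ⟨ht, Subset.antisymm hsub ?_⟩
      obtain ⟨x, hx⟩ := hiso
      have := hsub hx; rw [mem_singleton] at this; subst this
      exact singleton_subset_iff.2 hx
    have hnp : ¬ Peelable B (topCell B) := fun hp => by
      have := peel_eq_self_iff.1 hfix; exact this ⟨_, hp⟩
    rw [Peelable, not_and, not_and_or, not_not, not_not] at hnp
    rcases hnp hspike with hru | h3
    · right; right
      by_cases h3 : IsChain3 B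
      · exact Or.inl ⟨hL, hLR, h3⟩
      · exact Or.inr ⟨hL, hLR, h3, hru⟩
    · exact Or.inr (Or.inr (Or.inl ⟨hL, hLR, h3⟩))

/-! ### The base data theorem -/

/-- `UR e_i = a_{i+1}`: `UR (runCell t i) = roofCell t i`. [cite: MadrasSlade1993, §3.2 (proof of Theorem 3.2.3)] -/
theorem ur_runCell (t : Cell) (i : ℕ) : UR (runCell t i) = roofCell t i :=
  Prod.ext (by simp only [UR_fst, runCell_fst, roofCell_fst]; ring) (by simp)

/-- The 3-chain written top first. [cite: MadrasSlade1993, §3.2 (proof of Theorem 3.2.3)] -/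
theorem chain3_eq' (p : Cell) : ({p, UR p, UR (UR p)} : Finset Cell) = {UR (UR p), UR p, p} := by
  ext x; simp only [mem_insert, mem_singleton]; tauto

/-- ★ **Base data**: for a brick set `B` with polygonal boundary, at least two hexagons and no peelable top, the base image / port table / exceptional set
satisfy the port invariant, the `+2` law and polygonality. [cite: MadrasSlade1993, §3.2, Theorem 3.2.3 (3.2.3) and its proof pp. 64–65] -/
theorem base_data {B : Finset Cell} (hB : IsBrickSet B) (hP : IsPolygon brickWallGraph (bdry B)) (h2 : 2 ≤ #B) (hfix : peel B = B) :
    PortInv (baseExc B) B (baseImage B) (basePort B) ∧ perim (baseImage B) = perim B + 2 ∧ IsPolygon brickWallGraph (bdry (baseImage B)) := by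
  classical
  have hne : B.Nonempty := card_pos.1 (by omega)
  have ht := isLexmax_topCell hne
  have h3le : 3 ≤ perim B := by rw [← card_bdry hB]; exact three_le_card_of_isPolygon hP
  rcases base_cases hB hP h2 hfix with hL | ⟨hL, hLR⟩ | ⟨hL, hLR, h3⟩ | hru
  · -- class X
    have eI : baseImage B = flipImage B (topCell B) := by rw [baseImage, if_pos hL]
    have eP : basePort B = portX (topCell B) := by rw [basePort, if_pos hL]
    have eX : baseExc B = ∅ := by rw [baseExc, if_pos hL]
    rw [eI, eP, eX]
    exact ⟨portInv_flipImage hB ht hL, perim_flipImage ht hL, isPolygon_bdry_flipImage hB ht hL hP (by omega)⟩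
  · -- class R
    have eI : baseImage B = roofImage B (topCell B) := by rw [baseImage, if_neg hL, if_pos hLR]
    have eP : basePort B = portR (topCell B) (runLen B (topCell B)) := by rw [basePort, if_neg hL, if_pos hLR]
    have eX : baseExc B = roofExc B (topCell B) := by rw [baseExc, if_neg hL, if_pos hLR]
    rw [eI, eP, eX]
    exact ⟨portInv_roofImage hB ht hLR, perim_roofImage ht hLR, isPolygon_bdry_roofImage hB ht hP (four_le_perim_of_typeR ht hL)⟩
  · -- the 3-chain
    have eI : baseImage B = {UL (UR (chain3Base h3)), UR (chain3Base h3), R (chain3Base h3), chain3Base h3} := by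
      rw [baseImage, if_neg hL, if_neg hLR, dif_pos h3]
    have eP : basePort B = fun _ => UR (UL (UR (chain3Base h3))) := by rw [basePort, if_neg hL, if_neg hLR, dif_pos h3]
    have eX : baseExc B = ∅ := by rw [baseExc, if_neg hL, if_neg hLR]
    have e := chain3Base_spec h3
    have hpB : chain3Base h3 ∈ B := (Finset.ext_iff.1 e (chain3Base h3)).2 (by simp)
    have hp : Even ((chain3Base h3).1 + (chain3Base h3).2) := hB _ hpB
    have e' : ({UR (UR (chain3Base h3)), UR (chain3Base h3), chain3Base h3} : Finset Cell) = B := by rw [← chain3_eq']; exact e.symm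
    have k1 := portInv_F2 hp
    have k2 := perim_F2_eq_perim_chain3_add_two (chain3Base h3)
    have hP' : IsPolygon brickWallGraph (bdry ({UR (UR (chain3Base h3)), UR (chain3Base h3), chain3Base h3} : Finset Cell)) := by
      rw [e']; exact hP
    rw [e'] at k1 k2
    rw [eI, eP, eX]
    exact ⟨k1, k2, isPolygon_bdry_F2 hp hP'⟩
  · -- the RU-family
    obtain ⟨ht₀, hL₀, hk, hrun, hend, hll⟩ := ruSpec hru
    have h3 : ¬ IsChain3 B := hru.2.2.1
    have hL : L (topCell B) ∉ B := hru.1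
    have hLR : LR (topCell B) ∉ B := hru.2.1
    have htop : topCell B = roofCell (ruTop hru) (ruLen hru - 1) := by
      rw [← ur_runCell, ← hll]; ext <;> simp
    set B₀ := B.erase (topCell B) with hB₀
    have hB₀b : IsBrickSet B₀ := fun c hc => hB c (mem_of_mem_erase hc)
    have hBeq : B = insert (roofCell (ruTop hru) (ruLen hru - 1)) B₀ := by rw [← htop, hB₀, insert_erase ht.1]
    have eX : baseExc B = ∅ := by rw [baseExc, if_neg hL, if_neg hLR]
    by_cases hfl : L (chainCell (ruTop hru) (chainIdx B₀ (ruTop hru))) ∈ B₀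
    · have eI : baseImage B = ruFlipImage B₀ (ruTop hru) (ruLen hru) := by
        rw [baseImage, if_neg hL, if_neg hLR, dif_neg h3, dif_pos hru, if_pos hfl]
      have eP : basePort B = ruFlipPort B₀ (ruTop hru) := by
        rw [basePort, if_neg hL, if_neg hLR, dif_neg h3, dif_pos hru, if_pos hfl]
      have k1 := portInv_ruFlip hB₀b ht₀ hk hrun hend hfl
      have k2 := perim_ruFlipImage (k := ruLen hru) ht₀ hfl
      rw [hBeq] at hP
      have k3 := isPolygon_bdry_ruFlipImage hB₀b ht₀ hk hrun hend hfl hP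
      rw [← hBeq] at k1 k2
      rw [eI, eP, eX]
      exact ⟨k1, k2, k3⟩
    · have eI : baseImage B = ruLeafImage B₀ (ruTop hru) (ruLen hru) := by
        rw [baseImage, if_neg hL, if_neg hLR, dif_neg h3, dif_pos hru, if_neg hfl]
      have eP : basePort B = ruLeafPort B₀ (ruTop hru) := by
        rw [basePort, if_neg hL, if_neg hLR, dif_neg h3, dif_pos hru, if_neg hfl]
      have k1 := portInv_ruLeaf hB₀b ht₀ hk hrun hend
      have k2 := perim_ruLeafImage ht₀ hk hrun hend hfl
      rw [hBeq] at hP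
      have k3 := isPolygon_bdry_ruLeafImage hB₀b ht₀ hL₀ hk hrun hend hfl hP
      rw [← hBeq] at k1 k2
      rw [eI, eP, eX]
      exact ⟨k1, k2, k3⟩

/-! ### The exceptional host is idle along the peeling -/

/-- ★ `hX` of part XXII: no peeled hexagon of `S` stands on an exceptional host of `peel S`. [cite: MadrasSlade1993, §3.2 (proof of Theorem 3.2.3)] -/
theorem omega_hX {S : Finset Cell} (hS : IsBrickSet S) : ∀ c ∈ S \ peel S, LL c ∉ baseExc (peel S) := by
  classical
  intro c hc
  rw [baseExc]
  split_ifs with hL hLR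
  · simp
  · -- class R: LEMMA X
    have hne : (peel S).Nonempty := ⟨_, hLR⟩
    have ht := isLexmax_topCell hne
    rw [roofExc]
    split_ifs with hk
    · rw [mem_singleton]; exact ll_ne_lastRun_of_mem_sdiff_peel hS ht hL hk hc
    · simp
  · simp

/-! ### THEOREM V -/

/-- **The image `ι S` of OMEGA** (recursive form with the assembled base data). [cite: MadrasSlade1993, §3.2, Theorem 3.2.3 (3.2.3)] -/
noncomputable def omegaImage (S : Finset Cell) : Finset Cell := (omegaRec baseImage basePort S).1

/-- ★★ **THEOREM V (validity of OMEGA)**: for a brick set `S` whose boundary is a honeycomb polygon and whose base has at least two hexagons, `ι S` is a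
brick set with `perim (ι S) = perim S + 2` whose boundary is again a honeycomb polygon.
[cite: MadrasSlade1993, §3.2, Theorem 3.2.3 (3.2.3) p. 64 and its proof pp. 64–65 (transplanted to `ℍ`; lane result)] -/
theorem theoremV {S : Finset Cell} (hS : IsBrickSet S) (hP : IsPolygon brickWallGraph (bdry S)) (h2 : 2 ≤ #(peel S)) :
    IsBrickSet (omegaImage S) ∧ perim (omegaImage S) = perim S + 2 ∧ IsPolygon brickWallGraph (bdry (omegaImage S)) := by
  classical
  have hb := isBrickSet_peel hS
  have hpoly := isPolygon_bdry_peel hS hP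
  have hfix : peel (peel S) = peel S := peel_eq_self_iff.2 (not_exists_peelable_peel S)
  obtain ⟨hinv, hperim, hpolyC⟩ := base_data hb hpoly h2 hfix
  have hX := omega_hX hS
  exact ⟨(portInv_omegaRec (C := baseImage) (P₀ := basePort) hS hX hinv).brickW, perim_omegaRec_eq_add_two hS hX hinv hperim,
    isPolygon_bdry_omegaRec hS hX hinv hpolyC⟩

end HexCell

end Literature.Probability.RandomPlanarGeometry.SAW
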